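import Summits.ResolutionOfSingularities.ResolutionOfSingularities.Theorems.MarkedTransferCampaignW46ThreefoldsRegime
import HarnessLib

/-!
# [OURS · L1 W4.6 rung (ii)] «HENCE TERMINATES» AS AN INDUCTION PRINCIPLE ON STATES — the exhaustion interface of the
# ∇-centred typed procedure, general regime and regime (ii) (proofs; pure logic over the campaign shapes)

Cell res-hironaka, LADDER-RESOLUTION rung L (D-0089), slot W4.6, rung (ii); seat res-L1-s46-pv-3 (gen 2). Host route
MarkedTransfer, host item `HypersurfaceOrderReductionDimLeThree` (stmt-16156); `--kind proof --supports` it.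

HONEST FRAMING. Everything below is OURS and pure logic (classical dependent choice) over the campaign shapes of
`Theorems/MarkedTransferCampaignW46TypedProcedure.lean` (`Resume`, `StepNabla`, `RunNabla`, `TerminatesNabla`) and the
rung-(ii) names of `…Threefolds.lean`. NOTHING here is a statement of H. Hironaka's manuscript (2017-03-23,
[Hironaka2017]) and nothing asserts that any statement of it holds. AI review is weaker than expert review.

## What this module adds (towards HONEST LIMIT 4 of the g0 summary: the «exhaustion half» is used through THIS interface)

`TerminatesNabla N Rd Rg` is a NEGATIVE statement («no infinite ∇-centred run inside `Rg`»). What a consumer of a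
termination rung needs is the POSITIVE form — Noetherian induction over the states of the procedure: a property of states
`(A, E, R)` (ambient datum, ideal exponent, résumé read by `Rd`, in the regime) that holds at a state as soon as it
holds at every ∇-SUCCESSOR state (every state reached by one ∇-step `s : StepNabla R A′` followed by any résumé `R′` of
the transform `E′` read by `Rd`, still in the regime) holds at EVERY state of the regime (`TerminatesNabla.induct`).
States with no ∇-successor in the regime (no admitted component centre, or no résumé of the transform — «`Sing` became
empty», or the regime is left) are the base case, discharged by the hypothesis vacuously. The converse holds too
(`terminatesNabla_of_induct`: apply the principle to «no infinite ∇-run starts here»), so the principle is EQUIVALENT to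
the rung shape. Regime (ii) instances: `TerminatesNablaII.induct`, and — by regime propagation
(`…ThreefoldsRegime`) — the induction ranges over ALL ∇-successors once the initial state is a threefold-hypersurface
state (`TerminatesNablaII.induct_top`).

The one non-trivial ingredient is dependent choice along a successor relation with DATA-valued links
(`exists_chain_of_forall_exists`): from «every bad state has a bad ∇-successor» an infinite `RunNabla` is assembled whose
transform equations `E (k+1) = (step k).E′` hold by construction.

References: shared module `…TypedProcedure.lean` v3 (p468540) + anchors v2 (p468263); `…Threefolds.lean` v3 (p476988);
`…ThreefoldsRegime.lean` (regime propagation). H. Hironaka, ms. 2017-03-23, Th. 16.13 p.87 l.26–28 («repeatedly but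
finitely many times»), §16.3 p.87 l.14–24 — scope only, under adjudication, not cited as fact. [Hironaka2017]
-/

noncomputable section

set_option linter.dupNamespace false -- mandated namespace of this single-conjunct summit

open CategoryTheory AlgebraicGeometry TopologicalSpace

namespace Summit.ResolutionOfSingularities.ResolutionOfSingularities.Theorems

namespace CampaignW46

open Literature.AlgebraicGeometry.Resolution
open Literature.AlgebraicGeometry.Hironaka2017
open Literature.AlgebraicGeometry.Hironaka2017.S02Preliminaries
open Literature.AlgebraicGeometry.Hironaka2017.Datum
open Literature.AlgebraicGeometry.Hironaka2017.S15ARSchemes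
open Literature.AlgebraicGeometry.Hironaka2017.S16Proof

universe u v w

/-! ## Dependent choice along a successor relation with data-valued links -/

/-- **Dependent choice with data-valued links.** If every «bad» element `x` of `σ` admits a bad element `y` together
with a link `T x y` (a TYPE of links, e.g. a blow-up step), then from a bad `x₀` there is an infinite chain
`f : ℕ → σ` of bad elements with links `t k : T (f k) (f (k+1))`, `f 0 = x₀`. (The links are functions of the chain:
the successor is CHOSEN once per element, so `f (k+1)` is definitionally the chosen successor of `f k`.) [folklore] -/
theorem exists_chain_of_forall_exists {σ : Type v} (T : σ → σ → Sort w) (bad : σ → Prop)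
    (h : ∀ x, bad x → ∃ y, bad y ∧ Nonempty (T x y)) (x₀ : σ) (h₀ : bad x₀) :
    ∃ (f : ℕ → σ) (_ : ∀ k, T (f k) (f (k + 1))), f 0 = x₀ ∧ ∀ k, bad (f k) := by
  have hn : ∀ x : {x // bad x}, ∃ y : {y // bad y}, Nonempty (T x.1 y.1) := fun x => by
    obtain ⟨y, hy, hT⟩ := h x.1 x.2
    exact ⟨⟨y, hy⟩, hT⟩
  choose nxt hnxt using hn
  let f : ℕ → {x // bad x} := fun k => Nat.rec (motive := fun _ => {x // bad x}) ⟨x₀, h₀⟩ (fun _ x => nxt x) k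
  exact ⟨fun k => (f k).1, fun k => Classical.choice (hnxt (f k)), rfl, fun k => (f k).2⟩

variable {n : ℕ} {p : ℕ} [Fact p.Prime] {K : Type u} [Field K] [CharP K p]
variable {N : Notions.{u} n} {Rd : Reading p K N} {Rg : Regime p K}

/-! ## `TerminatesNabla` as Noetherian induction over states -/

/-- **«HENCE TERMINATES» AS AN INDUCTION PRINCIPLE.** Let `P` be a property of states `(A, E, R)` of the typed procedure
(notion instance `N`). Suppose `TerminatesNabla N Rd Rg` and that `P` holds at every state in the regime `Rg` read by
`Rd` AS SOON AS it holds at all its ∇-SUCCESSORS in the regime (all `(A′, E′, R′)` with `s : StepNabla R A′` a ∇-step,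
`E′ = s.E′` its transform, `R′` any résumé of `E′` read by `Rd`, `Rg A′ E′`). Then `P` holds at every state of the
regime read by `Rd`. Proof: otherwise dependent choice (`exists_chain_of_forall_exists`) threads an infinite ∇-centred
run through bad states, contradicting `TerminatesNabla`. Pure logic; nothing of the manuscript is used. [folklore] -/
theorem TerminatesNabla.induct (hT : TerminatesNabla N Rd Rg)
    (P : ∀ (A : AmbientDatum p K) (E : IdealExponent A.Z), Resume N A E → Prop)
    (ih : ∀ (A : AmbientDatum p K) (E : IdealExponent A.Z) (R : Resume N A E), Rg A E → Rd A E R →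
      (∀ (A' : AmbientDatum p K) (s : StepNabla R A') (R' : Resume N A' s.E'),
        Rg A' s.E' → Rd A' s.E' R' → P A' s.E' R') → P A E R)
    {A : AmbientDatum p K} {E : IdealExponent A.Z} (R : Resume N A E) (hRg : Rg A E) (hRd : Rd A E R) :
    P A E R := by
  by_contra hP
  let σ := Σ' (A : AmbientDatum p K) (E : IdealExponent A.Z), Resume N A E
  let bad : σ → Prop := fun x => Rg x.1 x.2.1 ∧ Rd x.1 x.2.1 x.2.2 ∧ ¬ P x.1 x.2.1 x.2.2
  let T : σ → σ → Type _ := fun x y => {s : StepNabla x.2.2 y.1 // y.2.1 = s.E'}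
  have hsucc : ∀ x, bad x → ∃ y, bad y ∧ Nonempty (T x y) := by
    rintro ⟨A₁, E₁, R₁⟩ ⟨hRg₁, hRd₁, hP₁⟩
    by_contra hno
    apply hP₁
    refine ih A₁ E₁ R₁ hRg₁ hRd₁ fun A' s R' hRg' hRd' => ?_
    by_contra hP'
    exact hno ⟨⟨A', s.E', R'⟩, ⟨hRg', hRd', hP'⟩, ⟨⟨s, rfl⟩⟩⟩
  obtain ⟨f, t, -, hf⟩ := exists_chain_of_forall_exists T bad hsucc ⟨A, E, R⟩ ⟨hRg, hRd, hP⟩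
  exact hT ⟨fun k => (f k).1, fun k => (f k).2.1, fun k => (f k).2.2, fun k => (hf k).2.1,
    fun k => (t k).1, fun k => (t k).2⟩ fun k => (hf k).1

/-- **The converse: the induction principle IS termination.** If the induction principle over ∇-successors holds for
every property of states in the regime, then `TerminatesNabla N Rd Rg` (apply it to «no ∇-centred run inside `Rg` has
this state as its stage `0`»). Pure logic. [folklore] -/
theorem terminatesNabla_of_induct
    (h : ∀ P : ∀ (A : AmbientDatum p K) (E : IdealExponent A.Z), Resume N A E → Prop,
      (∀ (A : AmbientDatum p K) (E : IdealExponent A.Z) (R : Resume N A E), Rg A E → Rd A E R →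
        (∀ (A' : AmbientDatum p K) (s : StepNabla R A') (R' : Resume N A' s.E'),
          Rg A' s.E' → Rd A' s.E' R' → P A' s.E' R') → P A E R) →
      ∀ (A : AmbientDatum p K) (E : IdealExponent A.Z) (R : Resume N A E), Rg A E → Rd A E R → P A E R) :
    TerminatesNabla N Rd Rg := by
  -- transport of a résumé along an equality of ideal exponents (the transform equation of a run)
  have key : ∀ {A : AmbientDatum p K} {E₁ E₂ : IdealExponent A.Z} (e : E₁ = E₂) (R : Resume N A E₁),
      (⟨A, E₁, R⟩ : Σ' (A : AmbientDatum p K) (E : IdealExponent A.Z), Resume N A E) = ⟨A, E₂, e ▸ R⟩ := by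
    intro A E₁ E₂ e R
    subst e
    rfl
  have keyRd : ∀ {A : AmbientDatum p K} {E₁ E₂ : IdealExponent A.Z} (e : E₁ = E₂) (R : Resume N A E₁),
      Rd A E₁ R → Rd A E₂ (e ▸ R) := by
    intro A E₁ E₂ e R hR
    subst e
    exact hR
  -- `P A E R` := no ∇-centred run inside `Rg` has the state `(A, E, R)` as its stage `0`
  let P : ∀ (A : AmbientDatum p K) (E : IdealExponent A.Z), Resume N A E → Prop := fun A E R =>
    ∀ r : RunNabla N Rd, (∀ k, Rg (r.A k) (r.E k)) →
      (⟨r.A 0, r.E 0, r.R 0⟩ : Σ' (A : AmbientDatum p K) (E : IdealExponent A.Z), Resume N A E) ≠ ⟨A, E, R⟩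
  have hP : ∀ (A : AmbientDatum p K) (E : IdealExponent A.Z) (R : Resume N A E), Rg A E → Rd A E R → P A E R := by
    refine h P fun A E R _ _ hsucc r hr heq => ?_
    cases heq
    -- the tail of `r` is a run inside `Rg` from the ∇-successor `(A 1, E 1 = (step 0).E′, R 1)` of stage `0`
    have hE1 : r.E 1 = (r.step 0).toStep.E' := r.E_succ 0
    have hRg1 : Rg (r.A 1) (r.step 0).toStep.E' := by
      rw [← hE1]
      exact hr 1
    exact hsucc (r.A 1) (r.step 0) (hE1 ▸ r.R 1) hRg1 (keyRd hE1 (r.R 1) (r.reads 1))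
      ⟨fun k => r.A (k + 1), fun k => r.E (k + 1), fun k => r.R (k + 1), fun k => r.reads (k + 1),
        fun k => r.step (k + 1), fun k => r.E_succ (k + 1)⟩
      (fun k => hr (k + 1)) (key hE1 (r.R 1))
  intro r hr
  exact hP (r.A 0) (r.E 0) (r.R 0) (hr 0) (r.reads 0) r hr rfl

/-! ## Regime (ii) instances -/

/-- **RUNG (ii) AS AN INDUCTION PRINCIPLE**: under `TerminatesNablaII N Rd`, a property of threefold-hypersurface states
read by `Rd` that is inherited from all ∇-successor threefold-hypersurface states holds at all of them. [folklore] -/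
theorem TerminatesNablaII.induct (hT : TerminatesNablaII N Rd)
    (P : ∀ (A : AmbientDatum p K) (E : IdealExponent A.Z), Resume N A E → Prop)
    (ih : ∀ (A : AmbientDatum p K) (E : IdealExponent A.Z) (R : Resume N A E), regimeII A E → Rd A E R →
      (∀ (A' : AmbientDatum p K) (s : StepNabla R A') (R' : Resume N A' s.E'),
        regimeII A' s.E' → Rd A' s.E' R' → P A' s.E' R') → P A E R)
    {A : AmbientDatum p K} {E : IdealExponent A.Z} (R : Resume N A E) (hRg : regimeII A E) (hRd : Rd A E R) :
    P A E R :=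
  TerminatesNabla.induct hT P ih R hRg hRd

/-- **RUNG (ii) AS AN INDUCTION PRINCIPLE OVER ALL ∇-SUCCESSORS.** By regime propagation (`Step.regimeII_transform`)
every ∇-successor of a threefold-hypersurface state is one, so under `TerminatesNablaII N Rd` a property of states that is
inherited from ALL ∇-successors read by `Rd` (no regime condition to check) holds at every threefold-hypersurface state
read by `Rd`. [folklore] -/
theorem TerminatesNablaII.induct_top (hT : TerminatesNablaII N Rd)
    (P : ∀ (A : AmbientDatum p K) (E : IdealExponent A.Z), Resume N A E → Prop)
    (ih : ∀ (A : AmbientDatum p K) (E : IdealExponent A.Z) (R : Resume N A E), regimeII A E → Rd A E R →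
      (∀ (A' : AmbientDatum p K) (s : StepNabla R A') (R' : Resume N A' s.E'), Rd A' s.E' R' → P A' s.E' R') →
        P A E R)
    {A : AmbientDatum p K} {E : IdealExponent A.Z} (R : Resume N A E) (hRg : regimeII A E) (hRd : Rd A E R) :
    P A E R :=
  TerminatesNabla.induct hT P (fun A E R hRg hRd hs => ih A E R hRg hRd fun A' s R' hRd' =>
    hs A' s R' (s.toStep.regimeII_transform hRg) hRd') R hRg hRd

end CampaignW46

end Summit.ResolutionOfSingularities.ResolutionOfSingularities.Theorems

end
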